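import Literature.NumberTheory.QuadraticForms.HermitianUnimodularRankTwoDetClass   -- ★ (r1-ENGINE): `HermitianUnimodularRamified.exists_formCongr_eq_of_det_eq_mul_norm`
import Literature.NumberTheory.Automorphic.UnitaryGroupSelfDualLocus                 -- ★ inert file: `exists_mem_glInt_coe_eq_formCongr`, `exists_mem_unitaryGroupOfForm_mul_of_formCongr_eq`
import Literature.NumberTheory.Automorphic.HeckeTransversalGL                       -- ★ `valuation_det_eq_one_of_mem_glInt`
import HarnessLib

/-!
# The self-dual locus of `GL₂(E_w)` is `U(J)(E_w) · GL₂(𝒪_w)` at a TAMELY RAMIFIED place: the unitary group of a unimodular hermitian PLANE over a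
# quadratic extension with residually trivial conjugation is transitive on self-dual lattices (Jacobowitz 1962, §8)

Topic `NumberTheory/Automorphic`; namespace `Literature.NumberTheory.Automorphic.UnitaryGroup`.  KERNEL ONLY: theorems, no definition, no instance, no notation, no
named fact, no `sorry`.  Cell `pub/hodgecm-mathlib`, F0∕P3a, crux H413 = stmt-HodgeConjecture-24833, line «N6nsGerm», (R2) Euler–Poincaré road, RAMIFIED half,
census `F0/P3a/A-p06/g27/CENSUS-R2ram-RamifiedEulerPoincare.A-p06g27.md` §5 (r1-A) (LEAD F0P3a-plan (g10) T9-8 (B); seat A-p06 (g27); consumer = transitivity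
binder `hA` of A-p17 (g22)'s (T4) `RankOneEulerPoincareEllipticRelationOfTree` and of A-p06's (N2b-lattice)).  HONEST LABEL: HC_CM is proved only modulo the
printed citations until rung 0 closes.

THE RAMIFIED TWIN of ★ `exists_mem_unitaryGroupOfForm_mul_of_selfDual` (`UnitaryGroupSelfDualLocus`, unramified: (trace) + (norm) «every σ-fixed unit is a
norm»).  At a ramified place (norm) fails, but rank `2` is rescued by the DETERMINANT CLASS: two unimodular hermitian Gram matrices of the SAME hermitian plane
`(E², J)` differ in determinant by the norm `det g · σ(det g)`, `det g ∈ 𝒪^×`, so the engine ★ `HermitianUnimodularRamified.exists_formCongr_eq_of_det_eq_mul_norm`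
(hypotheses (two) `2 ∈ 𝒪^×`, (res) `σ r − r ∈ 𝔪`, (norm₁) «σ-fixed principal units are norms», finite residue field) makes them `GL₂(𝒪)`-congruent, and the
algebra ★ `exists_mem_unitaryGroupOfForm_mul_of_formCongr_eq` turns the congruence into `g = u k`, `u ∈ U(J)`, `k ∈ GL₂(𝒪)`.

* §1 `valuation_det_eq_one_of_formCongr_mem_glInt` — if `J` and the Gram matrix `(σg)ᵀ J g` both lie in `GL₂(𝒪)` then `|det g| = 1` (`σ` valuation-preserving).
* §2 **`exists_mem_unitaryGroupOfForm_mul_of_selfDual_of_detClass`** (hypothesis-driven, any valued field `E` with an `𝒪`-preserving, valuation-preserving involution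
  `σ` satisfying (two), (res), (norm₁) on `𝒪[E]` and `𝓀[E]` finite): `J ∈ GL₂(𝒪)` `σ`-hermitian, `(σg)ᵀ J g ∈ GL₂(𝒪)` ⇒ `g = u k`; and the dictionary form
  **`exists_mem_unitaryGroupOfForm_mul_iff_of_detClass`**.

NOT here (next file): the discharge of (two)(res)(norm₁) at a tamely ramified CM place `w ∣ v`, `v ∤ 2` (★ `valued_galAdicCompletionMap_sub_lt_one_of_ramified` for
(res); Hensel in the complete DVR `𝒪_w` for (norm₁): a `σ`-fixed principal unit is a square `s²` with `σ s = s`, as `σ s = −s` would force `2 ∈ 𝔪`).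

## References
* [Jacobowitz1962] R. Jacobowitz, *Hermitian forms over local fields*, Amer. J. Math. 84 (1962), §8.
* [Kottwitz1992] R. E. Kottwitz, *Points on some Shimura varieties over finite fields*, JAMS 5 (1992), §7 Lemma 7.2, Cor. 7.3 (the `u k` decomposition).
* [Omeara1963] O. T. O'Meara, *Introduction to Quadratic Forms* (1963), §92.
-/

set_option autoImplicit false

open scoped Matrix ValuativeRel
open ValuativeRel

namespace Literature.NumberTheory.Automorphic.UnitaryGroup

open Literature.NumberTheory.Automorphic Literature.NumberTheory.QuadraticForms

variable {E : Type*} [Field E] [ValuativeRel E] (σ : E →+* E)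

/-! ## §1 The determinant of a frame of a self-dual lattice is a unit -/

/-- **`|det g| = 1` when `J` and `(σg)ᵀ J g` are both unimodular** (`σ` valuation-preserving): `det ((σg)ᵀ J g) = det J · det g · σ(det g)`, and all three of
`det ((σg)ᵀ J g)`, `det J` have valuation `1`. [cite: Omeara1963, §82:13] [cite: Jacobowitz1962, §8] -/
theorem valuation_det_eq_one_of_formCongr_mem_glInt (hσv : ∀ x : E, valuation E (σ x) = valuation E x) {n : ℕ}
    (J : GL (Fin n) E) (hJ : J ∈ glInt n E) (g : GL (Fin n) E)
    (hg : ∃ J' ∈ glInt n E, (J' : Matrix (Fin n) (Fin n) E) = formCongr σ g (J : Matrix (Fin n) (Fin n) E)) :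
    valuation E (g : Matrix (Fin n) (Fin n) E).det = 1 := by
  obtain ⟨J', hJ', hgJ⟩ := hg
  have h1 := valuation_det_eq_one_of_mem_glInt hJ'
  rw [hgJ, HermitianUnimodularRamified.det_formCongr, map_mul, map_mul, valuation_det_eq_one_of_mem_glInt hJ, one_mul, hσv, ← pow_two] at h1
  rcases pow_eq_one_iff.1 h1 with h | h
  · exact h
  · exact absurd h two_ne_zero

/-! ## §2 The `u k` decomposition from the determinant-class engine -/

/-- **`U(J)(E)` IS TRANSITIVE ON SELF-DUAL LATTICES OF A HERMITIAN PLANE, ramified signature** (hypothesis-driven).  `E` a valued field, `σ` an involution preserving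
`𝒪 = 𝒪[E]` and the valuation, with, on `𝒪`: (two) `2 ∈ 𝒪^×`, (res) `σ r − r ∈ 𝔪` (residually trivial conjugation — the RAMIFIED signature), (norm₁) every `σ`-fixed
principal unit is a norm `t σ t`, and `𝓀[E]` finite.  If `J ∈ GL₂(𝒪)` is `σ`-hermitian and the Gram matrix `(σg)ᵀ J g` of `g ∈ GL₂(E)` lies in `GL₂(𝒪)` (the
lattice `g 𝒪²` is self-dual), then `g = u k` with `u ∈ U(J)(E)` and `k ∈ GL₂(𝒪)` — via the engine ★ `exists_formCongr_eq_of_det_eq_mul_norm` at `t = det g`.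
[cite: Jacobowitz1962, §8] [cite: Kottwitz1992, §7 Lemma 7.2, Cor. 7.3] -/
theorem exists_mem_unitaryGroupOfForm_mul_of_selfDual_of_detClass (hσσ : ∀ x, σ (σ x) = x) (hσO : ∀ x : 𝒪[E], σ x ∈ 𝒪[E])
    (hσv : ∀ x : E, valuation E (σ x) = valuation E x) [Finite 𝓀[E]]
    (h2 : IsUnit (2 : 𝒪[E])) (hres : ∀ r : 𝒪[E], (⟨σ r, hσO r⟩ : 𝒪[E]) - r ∈ IsLocalRing.maximalIdeal 𝒪[E])
    (hnorm₁ : ∀ u : 𝒪[E], σ u = u → u - 1 ∈ IsLocalRing.maximalIdeal 𝒪[E] → ∃ t : 𝒪[E], (t : E) * σ t = u)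
    (J : GL (Fin 2) E) (hJ : J ∈ glInt 2 E) (hJh : ((J : Matrix (Fin 2) (Fin 2) E).map σ)ᵀ = J)
    (g : GL (Fin 2) E) (hg : ∃ J' ∈ glInt 2 E, (J' : Matrix (Fin 2) (Fin 2) E) = formCongr σ g (J : Matrix (Fin 2) (Fin 2) E)) :
    ∃ u ∈ unitaryGroupOfForm σ (J : Matrix (Fin 2) (Fin 2) E), ∃ k ∈ glInt 2 E, g = u * k := by
  classical
  -- `det g ∈ 𝒪^×`
  have hdetg : valuation E (g : Matrix (Fin 2) (Fin 2) E).det = 1 := valuation_det_eq_one_of_formCongr_mem_glInt σ hσv J hJ g hg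
  obtain ⟨J', hJ', hgJ⟩ := hg
  obtain ⟨J₀, rfl⟩ := hJ
  obtain ⟨J₀', rfl⟩ := hJ'
  set τ : 𝒪[E] →+* 𝒪[E] := (σ.comp (𝒪[E]).subtype).codRestrict (𝒪[E]) fun x => hσO x with hτdef
  have hτ : ∀ x, τ (τ x) = x := fun x => Subtype.ext (hσσ x)
  have hcomp : ⇑(𝒪[E]).subtype ∘ ⇑τ = ⇑σ ∘ ⇑(𝒪[E]).subtype := funext fun _ => rfl
  have hinj : Function.Injective (fun M : Matrix (Fin 2) (Fin 2) 𝒪[E] => M.map (𝒪[E]).subtype) :=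
    Matrix.map_injective Subtype.val_injective
  have hcoe : ∀ M₀ : GL (Fin 2) 𝒪[E], ((Matrix.GeneralLinearGroup.map (𝒪[E]).subtype M₀ : GL (Fin 2) E) : Matrix (Fin 2) (Fin 2) E) =
      (M₀ : Matrix (Fin 2) (Fin 2) 𝒪[E]).map (𝒪[E]).subtype := fun _ => rfl
  -- hermitian-ness over `𝒪` is inherited from `E`
  have hherm : ∀ M₀ : GL (Fin 2) 𝒪[E],
      ((((Matrix.GeneralLinearGroup.map (𝒪[E]).subtype M₀ : GL (Fin 2) E) : Matrix (Fin 2) (Fin 2) E)).map σ)ᵀ =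
        (Matrix.GeneralLinearGroup.map (𝒪[E]).subtype M₀ : GL (Fin 2) E) →
      ((M₀ : Matrix (Fin 2) (Fin 2) 𝒪[E]).map τ)ᵀ = M₀ := by
    intro M₀ hM₀
    apply hinj
    change (((M₀ : Matrix (Fin 2) (Fin 2) 𝒪[E]).map τ)ᵀ).map _ = (M₀ : Matrix (Fin 2) (Fin 2) 𝒪[E]).map _
    rw [Matrix.transpose_map, Matrix.map_map, hcomp, ← Matrix.map_map, ← hcoe]
    exact hM₀
  have hJ₀h : ((J₀ : Matrix (Fin 2) (Fin 2) 𝒪[E]).map τ)ᵀ = J₀ := hherm J₀ hJh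
  have hJ₀'h : ((J₀' : Matrix (Fin 2) (Fin 2) 𝒪[E]).map τ)ᵀ = J₀' := by
    refine hherm J₀' ?_
    rw [hgJ]
    exact formCongr_hermitian σ hσσ g hJh
  -- the engine's hypotheses on `𝒪[E]`, in `τ`-form
  have hres' : ∀ r : 𝒪[E], τ r - r ∈ IsLocalRing.maximalIdeal 𝒪[E] := hres
  have hnorm₁' : ∀ u : 𝒪[E], τ u = u → u - 1 ∈ IsLocalRing.maximalIdeal 𝒪[E] → ∃ t : 𝒪[E], t * τ t = u := by
    intro u hu h1
    obtain ⟨t, ht⟩ := hnorm₁ u (congrArg Subtype.val hu) h1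
    exact ⟨t, Subtype.ext ht⟩
  haveI : Finite (IsLocalRing.ResidueField 𝒪[E]) := ‹Finite 𝓀[E]›
  -- the determinant class: `det J₀' = det J₀ · (t τ t)`, `t = det g ∈ 𝒪`
  have hdetg' : (g : Matrix (Fin 2) (Fin 2) E).det ∈ 𝒪[E] := (Valuation.mem_integer_iff _ _).2 hdetg.le
  set t : 𝒪[E] := ⟨(g : Matrix (Fin 2) (Fin 2) E).det, hdetg'⟩ with htdef
  have hdetrel : (J₀' : Matrix (Fin 2) (Fin 2) 𝒪[E]).det = (J₀ : Matrix (Fin 2) (Fin 2) 𝒪[E]).det * (t * τ t) := by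
    apply Subtype.val_injective
    have h1 : (((J₀' : Matrix (Fin 2) (Fin 2) 𝒪[E]).det : 𝒪[E]) : E) = ((J₀' : Matrix (Fin 2) (Fin 2) 𝒪[E]).map (𝒪[E]).subtype).det := by
      rw [← RingHom.mapMatrix_apply, ← RingHom.map_det]; rfl
    have h2 : (((J₀ : Matrix (Fin 2) (Fin 2) 𝒪[E]).det : 𝒪[E]) : E) = ((J₀ : Matrix (Fin 2) (Fin 2) 𝒪[E]).map (𝒪[E]).subtype).det := by
      rw [← RingHom.mapMatrix_apply, ← RingHom.map_det]; rfl
    change (((J₀' : Matrix (Fin 2) (Fin 2) 𝒪[E]).det : 𝒪[E]) : E) = ((J₀ : Matrix (Fin 2) (Fin 2) 𝒪[E]).det : E) * ((t : E) * σ (t : E))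
    rw [h1, h2, ← hcoe, ← hcoe, hgJ, HermitianUnimodularRamified.det_formCongr]
  -- the engine over `𝒪`
  obtain ⟨T₀, hT₀⟩ := HermitianUnimodularRamified.exists_formCongr_eq_of_det_eq_mul_norm τ hτ h2 hres' hnorm₁'
    (J₀ : Matrix (Fin 2) (Fin 2) 𝒪[E]) (J₀' : Matrix (Fin 2) (Fin 2) 𝒪[E]) hJ₀h (Matrix.isUnits_det_units J₀) hJ₀'h (Matrix.isUnits_det_units J₀')
    t hdetrel
  -- push the congruence forward along `𝒪 ↪ E`
  refine exists_mem_unitaryGroupOfForm_mul_of_formCongr_eq σ _ g (Matrix.GeneralLinearGroup.map (𝒪[E]).subtype T₀) ⟨T₀, rfl⟩ ?_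
  rw [← hgJ, hcoe J₀', ← hT₀, hcoe J₀]
  simp only [formCongr, Matrix.map_mul, Matrix.transpose_map, Matrix.map_map, hcomp]
  rfl

/-- **The dictionary `U(J)(E) ∕ K ≅ {self-dual lattices}` in the ramified signature**: under the hypotheses of
`exists_mem_unitaryGroupOfForm_mul_of_selfDual_of_detClass`, `g ∈ GL₂(E)` factors as `u k` (`u ∈ U(J)`, `k ∈ GL₂(𝒪)`) IFF its Gram matrix lies in `GL₂(𝒪)`.
[cite: Jacobowitz1962, §8] [cite: Kottwitz1992, §7 Cor. 7.3] -/
theorem exists_mem_unitaryGroupOfForm_mul_iff_of_detClass (hσσ : ∀ x, σ (σ x) = x) (hσO : ∀ x : 𝒪[E], σ x ∈ 𝒪[E])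
    (hσv : ∀ x : E, valuation E (σ x) = valuation E x) [Finite 𝓀[E]]
    (h2 : IsUnit (2 : 𝒪[E])) (hres : ∀ r : 𝒪[E], (⟨σ r, hσO r⟩ : 𝒪[E]) - r ∈ IsLocalRing.maximalIdeal 𝒪[E])
    (hnorm₁ : ∀ u : 𝒪[E], σ u = u → u - 1 ∈ IsLocalRing.maximalIdeal 𝒪[E] → ∃ t : 𝒪[E], (t : E) * σ t = u)
    (J : GL (Fin 2) E) (hJ : J ∈ glInt 2 E) (hJh : ((J : Matrix (Fin 2) (Fin 2) E).map σ)ᵀ = J) (g : GL (Fin 2) E) :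
    (∃ u ∈ unitaryGroupOfForm σ (J : Matrix (Fin 2) (Fin 2) E), ∃ k ∈ glInt 2 E, g = u * k) ↔
      ∃ J' ∈ glInt 2 E, (J' : Matrix (Fin 2) (Fin 2) E) = formCongr σ g (J : Matrix (Fin 2) (Fin 2) E) := by
  refine ⟨?_, exists_mem_unitaryGroupOfForm_mul_of_selfDual_of_detClass σ hσσ hσO hσv h2 hres hnorm₁ J hJ hJh g⟩
  rintro ⟨u, hu, k, hk, rfl⟩
  obtain ⟨J', hJ', hJ'eq⟩ := exists_mem_glInt_coe_eq_formCongr σ hσO J hJ k hk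
  refine ⟨J', hJ', ?_⟩
  rw [hJ'eq, formCongr_mul_eq_formCongr_formCongr, show formCongr σ u (J : Matrix (Fin 2) (Fin 2) E) = J from
    mem_unitaryGroupOfForm_iff.1 hu]

end Literature.NumberTheory.Automorphic.UnitaryGroup
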